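import Literature.Analysis.SegalBargmann.HermiteQuadratic
import Literature.NumberTheory.ConnesConsani2024.ProlateWaveCyclicPairs
import HarnessLib

/-!
# Connes–Consani–Moscovici 2024, §5.1 «Infinitesimal representation and prolate operator»: the metaplectic
# `𝔰𝔩₂`-triple `ϖ(h), ϖ(e_±)`, the Hermite operator `ϖ(k)`, the ladder `a, a^*`, and `W_λ = ϖ(𝒲_λ)` — TYPED over the
# tree's oscillator calculus, identities PROVED

LINE 1 — FRAMING: RH-FREE corpus literature (the standard infinitesimal metaplectic representation on `𝒮(ℝ)`; no
positivity statement; nothing here bears on the truth of RH); cell rh-crit, corpus C1, typer t14; bears_on: W-C/W-P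
(sequel, no leaf role).  WHAT THIS IS NOT: any claim about RH, any new conjecture, any route.

Source: A. Connes, C. Consani, H. Moscovici, *Zeta zeros and prolate wave operators*, Ann. Funct. Anal. 15 (2024)
= arXiv:2310.18423 [bib: `ConnesConsaniMoscovici2024`], §5.1, p0017:L1–L62 of the held text `paper:arxiv-2310.18423`
(locators `chunk:line`; equation labels as in the held tex: «(metaplrep)», «(b-k)»).

## Dictionary print ↦ tree (CITED, not retyped: `Literature.Analysis.SegalBargmann.*`, Folland 1989 §1.7 normalisation
`h_0 = 2^{1/4}e^{−πx²}`, `Z = x + (2π)⁻¹∂`, `Z^* = x − (2π)⁻¹∂`, `2π(D²+X²) = −(2π)⁻¹∂² + 2πx²`)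

CCM work on `L²(ℝ) ⊃ 𝒮(ℝ)`; the tree's carrier is `𝓢(EuclideanSpace ℝ σ, ℂ)` with a coordinate `j : σ` (CCM: `σ` a
singleton); every formula below is the printed one in the variable `x = x_j`, `∂ = ∂/∂x_j`.

| print (§5.1) | Lean | status |
|---|---|---|
| `ϖ(h) := x∂_x + ½`, `ϖ(e₊) := iπx²`, `ϖ(e₋) := (i/4π)∂_x²` «(metaplrep)» p0017:L11 | `mpH j`, `mpEPlus j`, `mpEMinus j` (continuous linear operators on `𝓢`) | defs |
| `k = i(e₋ − e₊)`, `ϖ(k) = πx² − (1/4π)∂_x²` «(b-k)» p0017:L14–L20 | `mpK j`, `mpK_apply`; `mpK_eq_half_hermiteOpCLM` (`ϖ(k) = ½ · 2π(D²+X²)` of `HermiteOscillator`) | def, PROVED |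
| "the Hermite operator with spectrum `{n + ½}`" and the Hermite functions `h_n` as eigenbasis p0017:L22–L30 | `mpK_herm` (`ϖ(k) h_α = (α_j + ½) h_α`, `h_α = hermiteSchwartz (herm α)`) | PROVED; `h_n` CITED = `herm` |
| `a = ∂/(2√(2π)) + x√(π/2)`, `a^* = −∂/(2√(2π)) + x√(π/2)` p0017:L41, `ϖ(k) = aa^* + a^*a` p0017:L42 | `annOp j = √(π/2)·Z_j`, `creOp j = √(π/2)·Z_j^*`, `annOp_apply`, `creOp_apply`, `mpK_hermiteSchwartz_eq_ladder` | defs, PROVED (on the Hermite span) |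
| `a h_0 = 0`, `a h_n = √(n/2) h_{n−1}`, `a^* h_n = √((n+1)/2) h_{n+1}` p0017:L47 | `annOp_vacuum`, `annOp_herm`, `creOp_herm` | PROVED |
| `n_± = ½(h ∓ i(e₊+e₋))` p0017:L31; `ϖ(n₊) = ∂²/8π + x∂/2 + πx²/2 + ¼ = a²`, `ϖ(n₋) = −∂²/8π + x∂/2 − πx²/2 + ¼ = −(a^*)²` p0017:L35–L38 | `mpNPlus j`, `mpNMinus j`, `mpNPlus_apply`, `mpNMinus_apply`, `mpNPlus_add_mpNMinus`; `mpNPlus_hermiteSchwartz` (`= a²`), `mpNMinus_hermiteSchwartz` (`= −(a^*)²`) on the Hermite span | defs, PROVED |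
| **Proposition** (unnumbered, §5.1 end; held tex «19.») p0017:L56–L62: "At the formal level `W_λ = ϖ(𝒲_λ)`, `𝒲_λ = h² + 4πλ²k − ¼`" (via «(WLambdaq1)» = eq. (5), `W_λ = −𝕊² + λ²𝐇 − ¼`, `𝕊 = −i(x∂+½)`, `𝐇 = −∂² + (2πq)²`, p0009:L10) | on `𝓢`: `mpW j lam := ϖ(h)² + 4πλ²ϖ(k) − ¼`, `mpW_eq` (`= ϖ(h)² + λ²𝐇 − ¼`, `𝐇 = 2π · hermiteOpCLM j`); on `C²` functions on `ℝ`, against the §3 typing (`prolateWaveOpFun`, `scalingOpFun`, `hermiteOpFun` of `ProlateWaveCyclicPairs.lean`, seat t12): `prolateWaveOpFun_eq_varpi` | def, PROVED |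

## What is NOT typed here

The Rodrigues display for `h_n` (p0017:L26; it prints the Gaussian factor as `e^{−πx²/2}`, while `h_0 = 2^{1/4}e^{−πx²}`
(p0008:L202) and orthonormality force `e^{−πx²}`) — the tree's `herm α` (Folland (1.81)) is CITED and the ladder
relations pin the normalisation; the Casimir value `ϖ(C) = −¾` and the decomposition of `L²(ℝ)` into the lowest-weight
`½`, `3/2` pieces (p0017:L51–L54; Folland 1989 Prop. 4.49); a second copy of the §3 objects `𝕊`, `𝐇`, `W_λ`, `h_{2n}`,
`dm` (decls of `ProlateWaveCyclicPairs.lean`, seat t12, cited).  References: [ConnesConsaniMoscovici2024] §5.1;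
[Folland1989] §1.7, Prop. 4.49 (tree files `Literature.Analysis.SegalBargmann.FockHermite`/`HermiteOscillator`/
`HermiteLadder`/`HermiteQuadratic`).
-/

noncomputable section

open Complex SchwartzMap MvPolynomial
open scoped Real LineDeriv

namespace Literature.NumberTheory.ConnesConsani2024

open Literature.Analysis.SegalBargmann

variable {σ : Type*} [Fintype σ] [DecidableEq σ]

section Metaplectic

variable (j : σ)

/-- `ϖ(h) := x∂_x + ½` «(metaplrep)» (p0017:L11), as a continuous linear operator on `𝓢`.
[cite: ConnesConsaniMoscovici2024, §5.1 eq. (metaplrep) p0017:L11] -/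
def mpH : 𝓢(EuclideanSpace ℝ σ, ℂ) →L[ℂ] 𝓢(EuclideanSpace ℝ σ, ℂ) :=
  (coordMulCLM j).comp (LineDeriv.lineDerivOpCLM ℂ 𝓢(EuclideanSpace ℝ σ, ℂ) (EuclideanSpace.single j (1 : ℝ))) +
    (1 / 2 : ℂ) • ContinuousLinearMap.id ℂ _

/-- `ϖ(e₊) := iπx²` «(metaplrep)» (p0017:L11). [cite: ConnesConsaniMoscovici2024, §5.1 eq. (metaplrep) p0017:L11] -/
def mpEPlus : 𝓢(EuclideanSpace ℝ σ, ℂ) →L[ℂ] 𝓢(EuclideanSpace ℝ σ, ℂ) :=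
  (I * π : ℂ) • (coordMulCLM j).comp (coordMulCLM j)

/-- `ϖ(e₋) := (i/4π)∂_x²` «(metaplrep)» (p0017:L11). [cite: ConnesConsaniMoscovici2024, §5.1 eq. (metaplrep) p0017:L11] -/
def mpEMinus : 𝓢(EuclideanSpace ℝ σ, ℂ) →L[ℂ] 𝓢(EuclideanSpace ℝ σ, ℂ) :=
  (I / (4 * π) : ℂ) • (LineDeriv.lineDerivOpCLM ℂ 𝓢(EuclideanSpace ℝ σ, ℂ) (EuclideanSpace.single j (1 : ℝ))).comp
    (LineDeriv.lineDerivOpCLM ℂ 𝓢(EuclideanSpace ℝ σ, ℂ) (EuclideanSpace.single j (1 : ℝ)))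

/-- `ϖ(k)` for the generator `k = i(e₋ − e₊)` of the maximal compact subgroup (p0017:L14): `ϖ(k) := i(ϖ(e₋) − ϖ(e₊))`.
[cite: ConnesConsaniMoscovici2024, §5.1 p0017:L14] -/
def mpK : 𝓢(EuclideanSpace ℝ σ, ℂ) →L[ℂ] 𝓢(EuclideanSpace ℝ σ, ℂ) := I • (mpEMinus j - mpEPlus j)

/-- `ϖ(h) f = x ∂f + ½ f` pointwise. [cite: ConnesConsaniMoscovici2024, §5.1 eq. (metaplrep) p0017:L11] -/
theorem mpH_apply (f : 𝓢(EuclideanSpace ℝ σ, ℂ)) (x : EuclideanSpace ℝ σ) :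
    mpH j f x = ((x j : ℝ) : ℂ) * (∂_{EuclideanSpace.single j (1 : ℝ)} f) x + 1 / 2 * f x := by
  have h : mpH j f x = coordMulCLM j (∂_{EuclideanSpace.single j (1 : ℝ)} f) x + 1 / 2 * f x := rfl
  rw [h, coordMulCLM_apply]

omit [DecidableEq σ] in
/-- `ϖ(e₊) f = iπ x² f` pointwise. [cite: ConnesConsaniMoscovici2024, §5.1 eq. (metaplrep) p0017:L11] -/
theorem mpEPlus_apply (f : 𝓢(EuclideanSpace ℝ σ, ℂ)) (x : EuclideanSpace ℝ σ) :
    mpEPlus j f x = I * π * (((x j : ℝ) : ℂ) ^ 2 * f x) := by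
  have h : mpEPlus j f x = (I * π : ℂ) * coordMulCLM j (coordMulCLM j f) x := rfl
  rw [h, coordMulCLM_apply, coordMulCLM_apply]
  ring

/-- `ϖ(e₋) f = (i/4π) ∂²f` pointwise. [cite: ConnesConsaniMoscovici2024, §5.1 eq. (metaplrep) p0017:L11] -/
theorem mpEMinus_apply (f : 𝓢(EuclideanSpace ℝ σ, ℂ)) (x : EuclideanSpace ℝ σ) :
    mpEMinus j f x =
      I / (4 * π) * (∂_{EuclideanSpace.single j (1 : ℝ)} (∂_{EuclideanSpace.single j (1 : ℝ)} f)) x :=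
  rfl

/-- «(b-k)» (p0017:L19): `ϖ(k) = πx² − (1/4π)∂_x²`. [cite: ConnesConsaniMoscovici2024, §5.1 eq. (b-k) p0017:L19] -/
theorem mpK_apply (f : 𝓢(EuclideanSpace ℝ σ, ℂ)) (x : EuclideanSpace ℝ σ) :
    mpK j f x = π * (((x j : ℝ) : ℂ) ^ 2 * f x) -
      1 / (4 * π) * (∂_{EuclideanSpace.single j (1 : ℝ)} (∂_{EuclideanSpace.single j (1 : ℝ)} f)) x := by
  have h : mpK j f x = I * (mpEMinus j f x - mpEPlus j f x) := rfl
  rw [h, mpEMinus_apply, mpEPlus_apply]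
  linear_combination (1 / (4 * π) * (∂_{EuclideanSpace.single j (1 : ℝ)} (∂_{EuclideanSpace.single j (1 : ℝ)} f)) x -
    π * (((x j : ℝ) : ℂ) ^ 2 * f x)) * I_sq

/-- `ϖ(k)` is one half of Folland's Hermite operator `2π(D_j² + X_j²) = −(2π)⁻¹∂² + 2πx²` (`hermiteOpCLM`,
Folland 1989 §1.7 (vi)) — the dictionary entry behind "ϖ(k) is the Hermite operator" (p0017:L14–L22).
[cite: ConnesConsaniMoscovici2024, §5.1 eq. (b-k) p0017:L19] -/
theorem mpK_eq_half_hermiteOpCLM : mpK j = (1 / 2 : ℂ) • hermiteOpCLM j := by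
  have hπ : (π : ℂ) ≠ 0 := Complex.ofReal_ne_zero.mpr Real.pi_ne_zero
  refine ContinuousLinearMap.ext fun f => SchwartzMap.ext fun x => ?_
  have h : ((1 / 2 : ℂ) • hermiteOpCLM j) f x = 1 / 2 * hermiteOpCLM j f x := rfl
  rw [mpK_apply, h, hermiteOpCLM_apply]
  field_simp
  ring

/-- "`ϖ(k)` is the Hermite operator with spectrum `{n + ½ ; n ∈ ℤ⁺}` and the Hermite functions provide the associated
eigenfunctions" (p0017:L22–L30): `ϖ(k) h_α = (α_j + ½) h_α` for the tree's Hermite functions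
`h_α = hermiteSchwartz (herm α)` (Folland's (1.83)(a) `hermiteOpCLM_herm`). [cite: ConnesConsaniMoscovici2024, §5.1 p0017:L22] -/
theorem mpK_herm (α : σ →₀ ℕ) :
    mpK j (hermiteSchwartz (herm α)) = ((α j : ℂ) + 1 / 2) • hermiteSchwartz (herm α) := by
  rw [mpK_eq_half_hermiteOpCLM]
  have h : ((1 / 2 : ℂ) • hermiteOpCLM j) (hermiteSchwartz (herm α)) =
      (1 / 2 : ℂ) • hermiteOpCLM j (hermiteSchwartz (herm α)) := rfl
  rw [h, hermiteOpCLM_herm, smul_smul]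
  congr 1; ring

end Metaplectic

/-! ## The annihilation and creation operators `a`, `a^*` and the ladder -/

section Ladder

variable (j : σ)

/-- `a = ∂/(2√(2π)) + x√(π/2)` (p0017:L41), i.e. `√(π/2) · Z_j` with Folland's `Z_j = x_j + (2π)⁻¹∂_j` (`zCLM`).
[cite: ConnesConsaniMoscovici2024, §5.1 p0017:L41] -/
def annOp : 𝓢(EuclideanSpace ℝ σ, ℂ) →L[ℂ] 𝓢(EuclideanSpace ℝ σ, ℂ) := (Real.sqrt (π / 2) : ℂ) • zCLM j

/-- `a^* = −∂/(2√(2π)) + x√(π/2)` (p0017:L41), i.e. `√(π/2) · Z_j^*` (`zsCLM`). [cite: ConnesConsaniMoscovici2024, §5.1 p0017:L41] -/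
def creOp : 𝓢(EuclideanSpace ℝ σ, ℂ) →L[ℂ] 𝓢(EuclideanSpace ℝ σ, ℂ) := (Real.sqrt (π / 2) : ℂ) • zsCLM j

/-- The constant `√(π/2)·(2π)⁻¹ = 1/(2√(2π))` (p0017:L41). [cite: ConnesConsaniMoscovici2024, §5.1 p0017:L41] -/
theorem sqrt_pi_div_two_div_two_pi : Real.sqrt (π / 2) / (2 * π) = 1 / (2 * Real.sqrt (2 * π)) := by
  have hπ : 0 < π := Real.pi_pos
  have h2 : Real.sqrt (π / 2) * Real.sqrt (2 * π) = π := by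
    rw [← Real.sqrt_mul (by positivity), show π / 2 * (2 * π) = π * π by ring, Real.sqrt_mul_self hπ.le]
  have hs : 0 < Real.sqrt (2 * π) := Real.sqrt_pos.mpr (by positivity)
  rw [div_eq_div_iff (by positivity) (by positivity), one_mul]
  linear_combination 2 * h2

/-- `a f = √(π/2)·(x f + (2π)⁻¹ ∂f)` pointwise, i.e. `x√(π/2) f + ∂f/(2√(2π))` by `sqrt_pi_div_two_div_two_pi`
(p0017:L41; `Z_j = x_j + iD_j`, `D_j = (2πi)⁻¹∂_j`). [cite: ConnesConsaniMoscovici2024, §5.1 p0017:L41] -/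
theorem annOp_apply (f : 𝓢(EuclideanSpace ℝ σ, ℂ)) (x : EuclideanSpace ℝ σ) :
    annOp j f x = (Real.sqrt (π / 2) : ℂ) *
      (((x j : ℝ) : ℂ) * f x + (2 * π : ℂ)⁻¹ * (∂_{EuclideanSpace.single j (1 : ℝ)} f) x) := by
  have h : annOp j f x = (Real.sqrt (π / 2) : ℂ) * (coordMulCLM j f x + I * opDCLM j f x) := rfl
  rw [h, coordMulCLM_apply, opDCLM_apply, ← mul_assoc I, I_mul_inv_two_pi_I]

/-- `a^* f = √(π/2)·(x f − (2π)⁻¹ ∂f)` pointwise, i.e. `x√(π/2) f − ∂f/(2√(2π))` (p0017:L41).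
[cite: ConnesConsaniMoscovici2024, §5.1 p0017:L41] -/
theorem creOp_apply (f : 𝓢(EuclideanSpace ℝ σ, ℂ)) (x : EuclideanSpace ℝ σ) :
    creOp j f x = (Real.sqrt (π / 2) : ℂ) *
      (((x j : ℝ) : ℂ) * f x - (2 * π : ℂ)⁻¹ * (∂_{EuclideanSpace.single j (1 : ℝ)} f) x) := by
  have h : creOp j f x = (Real.sqrt (π / 2) : ℂ) * (coordMulCLM j f x - I * opDCLM j f x) := rfl
  rw [h, coordMulCLM_apply, opDCLM_apply, ← mul_assoc I, I_mul_inv_two_pi_I]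

/-- `√(π/2)·√(t/π) = √(t/2)` for `t ≥ 0` (the constant in the ladder relations). [cite: ConnesConsaniMoscovici2024, §5.1 p0017:L47] -/
theorem sqrt_pi_div_two_mul_sqrt_div_pi (t : ℝ) :
    Real.sqrt (π / 2) * Real.sqrt (t / π) = Real.sqrt (t / 2) := by
  have hπ : 0 < π := Real.pi_pos
  rw [← Real.sqrt_mul (by positivity)]
  congr 1
  field_simp

/-- **`a (h_0) = 0`** (p0017:L47): the Gaussian `h_0 = hermiteSchwartz (vac σ)` (`= 2^{|σ|/4}e^{−π|x|²}`,
Folland's vacuum; CCM's `2^{1/4}e^{−πx²}`, p0008:L202) is annihilated. [cite: ConnesConsaniMoscovici2024, §5.1 p0017:L47] -/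
theorem annOp_vacuum : annOp j (hermiteSchwartz (vac σ)) = 0 := by
  have h : annOp j (hermiteSchwartz (vac σ)) = (Real.sqrt (π / 2) : ℂ) • zCLM j (hermiteSchwartz (vac σ)) := rfl
  rw [h, zCLM_vacuum, smul_zero]

/-- **`a (h_n) = √(n/2) h_{n−1}`** (p0017:L47), for the tree's Hermite functions `h_α` and `n = α_j`
(from Folland (1.82) `Z_j h_α = √(α_j/π) h_{α−1_j}`, `zCLM_herm`). [cite: ConnesConsaniMoscovici2024, §5.1 p0017:L47] -/
theorem annOp_herm (α : σ →₀ ℕ) :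
    annOp j (hermiteSchwartz (herm α)) =
      (Real.sqrt (α j / 2) : ℂ) • hermiteSchwartz (herm (α - Finsupp.single j 1)) := by
  have h : annOp j (hermiteSchwartz (herm α)) = (Real.sqrt (π / 2) : ℂ) • zCLM j (hermiteSchwartz (herm α)) := rfl
  rw [h, zCLM_herm, smul_smul, ← Complex.ofReal_mul, sqrt_pi_div_two_mul_sqrt_div_pi]

/-- **`a^* (h_n) = √((n+1)/2) h_{n+1}`** (p0017:L47), for `h_α`, `n = α_j` (from Folland (1.82), `zsCLM_herm`).
[cite: ConnesConsaniMoscovici2024, §5.1 p0017:L47] -/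
theorem creOp_herm (α : σ →₀ ℕ) :
    creOp j (hermiteSchwartz (herm α)) =
      (Real.sqrt ((α j + 1) / 2) : ℂ) • hermiteSchwartz (herm (α + Finsupp.single j 1)) := by
  have h : creOp j (hermiteSchwartz (herm α)) = (Real.sqrt (π / 2) : ℂ) • zsCLM j (hermiteSchwartz (herm α)) := rfl
  rw [h, zsCLM_herm, smul_smul, ← Complex.ofReal_mul, sqrt_pi_div_two_mul_sqrt_div_pi]

/-- `√(π/2)² = π/2` in `ℂ` (plumbing). [folklore] -/
private theorem sqrt_pi_div_two_sq : (Real.sqrt (π / 2) : ℂ) * (Real.sqrt (π / 2) : ℂ) = (π / 2 : ℂ) := by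
  rw [← Complex.ofReal_mul, Real.mul_self_sqrt (by positivity)]; push_cast; ring

/-- **`ϖ(k) = aa^* + a^*a`** (p0017:L42), on the Hermite span `hermiteSchwartz p` (finite linear combinations of
Hermite functions = polynomial × Gaussian — the domain on which §5 computes "at the formal level"); from
`2π(D²+X²) = 2πZ^*Z + 1` and `[Z,Z^*] = π⁻¹` (`hermiteOpCLM_eq_ladder_hermiteSchwartz`, `zCLM_zsCLM_self_binv`).
[cite: ConnesConsaniMoscovici2024, §5.1 p0017:L42] -/
theorem mpK_hermiteSchwartz_eq_ladder (p : MvPolynomial σ ℂ) :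
    mpK j (hermiteSchwartz p) =
      annOp j (creOp j (hermiteSchwartz p)) + creOp j (annOp j (hermiteSchwartz p)) := by
  obtain ⟨F, rfl⟩ := binv_surjective p
  have hπ : (π : ℂ) ≠ 0 := Complex.ofReal_ne_zero.mpr Real.pi_ne_zero
  have h0 : mpK j (hermiteSchwartz (binv F)) = (1 / 2 : ℂ) • hermiteOpCLM j (hermiteSchwartz (binv F)) := by
    rw [mpK_eq_half_hermiteOpCLM]; rfl
  have h1 : ∀ g : 𝓢(EuclideanSpace ℝ σ, ℂ), annOp j g = (Real.sqrt (π / 2) : ℂ) • zCLM j g := fun g => rfl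
  have h2 : ∀ g : 𝓢(EuclideanSpace ℝ σ, ℂ), creOp j g = (Real.sqrt (π / 2) : ℂ) • zsCLM j g := fun g => rfl
  rw [h0, hermiteOpCLM_eq_ladder_hermiteSchwartz, h2, h1, h1, h2, map_smul, map_smul, smul_smul, smul_smul,
    sqrt_pi_div_two_sq, zCLM_zsCLM_self_binv]
  simp only [smul_add, smul_smul]
  match_scalars <;> (field_simp; try ring)

end Ladder

/-! ## `n_±` and their second-order form -/

section NPlusMinus

variable (j : σ)

/-- `ϖ(n₊)` for `n₊ = ½(h − i(e₊ + e₋))` (p0017:L31). [cite: ConnesConsaniMoscovici2024, §5.1 p0017:L31] -/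
def mpNPlus : 𝓢(EuclideanSpace ℝ σ, ℂ) →L[ℂ] 𝓢(EuclideanSpace ℝ σ, ℂ) :=
  (1 / 2 : ℂ) • (mpH j - I • (mpEPlus j + mpEMinus j))

/-- `ϖ(n₋)` for `n₋ = ½(h + i(e₊ + e₋))` (p0017:L31). [cite: ConnesConsaniMoscovici2024, §5.1 p0017:L31] -/
def mpNMinus : 𝓢(EuclideanSpace ℝ σ, ℂ) →L[ℂ] 𝓢(EuclideanSpace ℝ σ, ℂ) :=
  (1 / 2 : ℂ) • (mpH j + I • (mpEPlus j + mpEMinus j))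

/-- `n₊ + n₋ = h`: `ϖ(n₊) + ϖ(n₋) = ϖ(h)` (p0017:L31). [cite: ConnesConsaniMoscovici2024, §5.1 p0017:L31] -/
theorem mpNPlus_add_mpNMinus : mpNPlus j + mpNMinus j = mpH j := by
  rw [mpNPlus, mpNMinus, ← smul_add, sub_add_add_cancel, ← two_smul ℂ (mpH j), smul_smul]
  norm_num

/-- The displayed second-order form `ϖ(n₊) = ∂²/(8π) + x∂/2 + ½πx² + ¼` (p0017:L35), pointwise.
[cite: ConnesConsaniMoscovici2024, §5.1 p0017:L35] -/
theorem mpNPlus_apply (f : 𝓢(EuclideanSpace ℝ σ, ℂ)) (x : EuclideanSpace ℝ σ) :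
    mpNPlus j f x = 1 / (8 * π) * (∂_{EuclideanSpace.single j (1 : ℝ)} (∂_{EuclideanSpace.single j (1 : ℝ)} f)) x +
      1 / 2 * (((x j : ℝ) : ℂ) * (∂_{EuclideanSpace.single j (1 : ℝ)} f) x) +
      π / 2 * (((x j : ℝ) : ℂ) ^ 2 * f x) + 1 / 4 * f x := by
  have h : mpNPlus j f x = (1 / 2 : ℂ) * (mpH j f x - I * (mpEPlus j f x + mpEMinus j f x)) := rfl
  rw [h, mpH_apply, mpEPlus_apply, mpEMinus_apply]
  linear_combination (-(π / 2 : ℂ) * (((x j : ℝ) : ℂ) ^ 2 * f x) -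
    1 / (8 * π) * (∂_{EuclideanSpace.single j (1 : ℝ)} (∂_{EuclideanSpace.single j (1 : ℝ)} f)) x) * I_sq

/-- The displayed second-order form `ϖ(n₋) = −∂²/(8π) + x∂/2 − ½πx² + ¼` (p0017:L37), pointwise.
[cite: ConnesConsaniMoscovici2024, §5.1 p0017:L37] -/
theorem mpNMinus_apply (f : 𝓢(EuclideanSpace ℝ σ, ℂ)) (x : EuclideanSpace ℝ σ) :
    mpNMinus j f x = -(1 / (8 * π)) * (∂_{EuclideanSpace.single j (1 : ℝ)} (∂_{EuclideanSpace.single j (1 : ℝ)} f)) x +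
      1 / 2 * (((x j : ℝ) : ℂ) * (∂_{EuclideanSpace.single j (1 : ℝ)} f) x) -
      π / 2 * (((x j : ℝ) : ℂ) ^ 2 * f x) + 1 / 4 * f x := by
  have h : mpNMinus j f x = (1 / 2 : ℂ) * (mpH j f x + I * (mpEPlus j f x + mpEMinus j f x)) := rfl
  rw [h, mpH_apply, mpEPlus_apply, mpEMinus_apply]
  linear_combination ((π / 2 : ℂ) * (((x j : ℝ) : ℂ) ^ 2 * f x) +
    1 / (8 * π) * (∂_{EuclideanSpace.single j (1 : ℝ)} (∂_{EuclideanSpace.single j (1 : ℝ)} f)) x) * I_sq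

omit [DecidableEq σ] in
/-- `hermiteSchwartz` respects subtraction of symbols (plumbing). [folklore] -/
private theorem hermiteSchwartz_sub' (p q : MvPolynomial σ ℂ) :
    hermiteSchwartz (p - q) = hermiteSchwartz p - hermiteSchwartz q :=
  map_sub (hermiteSchwartzₗ (σ := σ)) p q

omit [DecidableEq σ] in
/-- `hermiteSchwartz` respects negation of symbols (plumbing). [folklore] -/
private theorem hermiteSchwartz_neg' (q : MvPolynomial σ ℂ) : hermiteSchwartz (-q) = -hermiteSchwartz q :=
  map_neg (hermiteSchwartzₗ (σ := σ)) q

omit [Fintype σ] in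
/-- Symbol identity behind `ϖ(n₊) = a²` (plumbing): with `Δ = ∂_j − 2πx_j` the symbol of `∂_j` (`opDel`),
`½x_jΔp + ¼p + (π/2)x_j²p + (8π)⁻¹Δ²p = (8π)⁻¹∂_j²p`. [folklore] -/
private theorem nPlus_symbol (p : MvPolynomial σ ℂ) :
    (1 / 2 : ℂ) • (X j * opDel j p) + (1 / 4 : ℂ) • p + ((π : ℂ) / 2) • (X j * (X j * p)) +
        (1 / (8 * π) : ℂ) • opDel j (opDel j p) =
      (1 / (8 * π) : ℂ) • pderiv j (pderiv j p) := by
  have hπ : (π : ℂ) ≠ 0 := Complex.ofReal_ne_zero.mpr Real.pi_ne_zero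
  simp only [opDel_apply, map_sub, map_smul, pderiv_X_mul, if_true, smul_sub, smul_add, mul_sub,
    mul_smul_comm, smul_smul]
  match_scalars <;> field_simp <;> ring

omit [Fintype σ] in
/-- Symbol identity behind `ϖ(n₋) = −(a^*)²` (plumbing):
`½x_jΔp + ¼p − (π/2)x_j²p − (8π)⁻¹Δ²p = −(π/2)·(2x_j − (2π)⁻¹∂_j)²p`. [folklore] -/
private theorem nMinus_symbol (p : MvPolynomial σ ℂ) :
    (1 / 2 : ℂ) • (X j * opDel j p) + (1 / 4 : ℂ) • p - ((π : ℂ) / 2) • (X j * (X j * p)) -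
        (1 / (8 * π) : ℂ) • opDel j (opDel j p) =
      -(((π : ℂ) / 2) • opZs j (opZs j p)) := by
  have hπ : (π : ℂ) ≠ 0 := Complex.ofReal_ne_zero.mpr Real.pi_ne_zero
  simp only [opDel_apply, opZs_apply, map_sub, map_smul, pderiv_X_mul, if_true, smul_sub, smul_add, mul_sub,
    mul_smul_comm, smul_smul, neg_sub]
  match_scalars <;> field_simp <;> ring

/-- **`ϖ(n₊) = a²`** (p0017:L36) on the Hermite span: `ϖ(n₊)(hermiteSchwartz p) = a(a(hermiteSchwartz p))`.
[cite: ConnesConsaniMoscovici2024, §5.1 p0017:L36] -/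
theorem mpNPlus_hermiteSchwartz (p : MvPolynomial σ ℂ) :
    mpNPlus j (hermiteSchwartz p) = annOp j (annOp j (hermiteSchwartz p)) := by
  have hL : mpNPlus j (hermiteSchwartz p) = (1 / 2 : ℂ) •
      ((coordMulCLM j (∂_{EuclideanSpace.single j (1 : ℝ)} (hermiteSchwartz p)) + (1 / 2 : ℂ) • hermiteSchwartz p) -
        I • ((I * π : ℂ) • coordMulCLM j (coordMulCLM j (hermiteSchwartz p)) +
          (I / (4 * π) : ℂ) • ∂_{EuclideanSpace.single j (1 : ℝ)} (∂_{EuclideanSpace.single j (1 : ℝ)}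
            (hermiteSchwartz p)))) := rfl
  have hR : annOp j (annOp j (hermiteSchwartz p)) =
      (Real.sqrt (π / 2) : ℂ) • zCLM j ((Real.sqrt (π / 2) : ℂ) • zCLM j (hermiteSchwartz p)) := rfl
  rw [hL, hR, lineDerivOp_single_hermiteSchwartz, lineDerivOp_single_hermiteSchwartz, coordMulCLM_hermiteSchwartz,
    coordMulCLM_hermiteSchwartz, coordMulCLM_hermiteSchwartz, map_smul, zCLM_hermiteSchwartz, zCLM_hermiteSchwartz,
    smul_smul, sqrt_pi_div_two_sq]
  simp only [opX_apply, ← hermiteSchwartz_smul, ← hermiteSchwartz_add, ← hermiteSchwartz_sub']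
  congr 1
  have hπ : (π : ℂ) ≠ 0 := Complex.ofReal_ne_zero.mpr Real.pi_ne_zero
  have hr : ((π : ℂ) / 2) • opZ j (opZ j p) = (1 / (8 * π) : ℂ) • pderiv j (pderiv j p) := by
    simp only [opZ_apply, map_smul, smul_smul]
    congr 1
    field_simp
    ring
  rw [hr, ← nPlus_symbol j p]
  have hI1 : I * (I * (π : ℂ)) = -π := by rw [← mul_assoc, I_mul_I]; ring
  have hI2 : I * (I / (4 * (π : ℂ))) = -(1 / (4 * π)) := by rw [← mul_div_assoc, I_mul_I]; ring
  simp only [smul_add, smul_sub, smul_smul, hI1, hI2]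
  module

/-- **`ϖ(n₋) = −(a^*)²`** (p0017:L38) on the Hermite span: `ϖ(n₋)(hermiteSchwartz p) = −a^*(a^*(hermiteSchwartz p))`.
[cite: ConnesConsaniMoscovici2024, §5.1 p0017:L38] -/
theorem mpNMinus_hermiteSchwartz (p : MvPolynomial σ ℂ) :
    mpNMinus j (hermiteSchwartz p) = -(creOp j (creOp j (hermiteSchwartz p))) := by
  have hL : mpNMinus j (hermiteSchwartz p) = (1 / 2 : ℂ) •
      ((coordMulCLM j (∂_{EuclideanSpace.single j (1 : ℝ)} (hermiteSchwartz p)) + (1 / 2 : ℂ) • hermiteSchwartz p) +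
        I • ((I * π : ℂ) • coordMulCLM j (coordMulCLM j (hermiteSchwartz p)) +
          (I / (4 * π) : ℂ) • ∂_{EuclideanSpace.single j (1 : ℝ)} (∂_{EuclideanSpace.single j (1 : ℝ)}
            (hermiteSchwartz p)))) := rfl
  have hR : creOp j (creOp j (hermiteSchwartz p)) =
      (Real.sqrt (π / 2) : ℂ) • zsCLM j ((Real.sqrt (π / 2) : ℂ) • zsCLM j (hermiteSchwartz p)) := rfl
  rw [hL, hR, lineDerivOp_single_hermiteSchwartz, lineDerivOp_single_hermiteSchwartz, coordMulCLM_hermiteSchwartz,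
    coordMulCLM_hermiteSchwartz, coordMulCLM_hermiteSchwartz, map_smul, zsCLM_hermiteSchwartz, zsCLM_hermiteSchwartz,
    smul_smul, sqrt_pi_div_two_sq]
  simp only [opX_apply, ← hermiteSchwartz_smul, ← hermiteSchwartz_add, ← hermiteSchwartz_neg']
  congr 1
  rw [← nMinus_symbol j p]
  have hI1 : I * (I * (π : ℂ)) = -π := by rw [← mul_assoc, I_mul_I]; ring
  have hI2 : I * (I / (4 * (π : ℂ))) = -(1 / (4 * π)) := by rw [← mul_div_assoc, I_mul_I]; ring
  simp only [smul_add, smul_smul, hI1, hI2]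
  module

end NPlusMinus

/-! ## The prolate wave operator as `ϖ(𝒲_λ)` -/

section Prolate

variable (j : σ) (lam : ℝ)

/-- **Proposition (§5.1, unnumbered; p0017:L56–L62)**: "At the formal level the operator `W_λ` is of the form `ϖ(𝒲_λ)`
where `𝒲_λ = h² + 4πλ²k − ¼ ∈ 𝒰(𝔰𝔩(2,ℝ))`."  We DEFINE `ϖ(𝒲_λ) := ϖ(h)² + 4πλ²ϖ(k) − ¼` on `𝓢` and prove below
that it equals `ϖ(h)² + λ²𝐇 − ¼` with `𝐇 = −∂² + (2πq)²` (§3.3) — which is `W_λ` by «(WLambdaq1)» / eq. (1) p0006:L48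
and the identity `W_λ = −S² + λ²𝐇 − ¼`, `S = −i(x∂ + ½) = −iϖ(h)` (p0008:L193, p0009:L10).
[cite: ConnesConsaniMoscovici2024, §5.1 Prop. p0017:L56–L62] -/
def mpW : 𝓢(EuclideanSpace ℝ σ, ℂ) →L[ℂ] 𝓢(EuclideanSpace ℝ σ, ℂ) :=
  (mpH j).comp (mpH j) + (4 * π * lam ^ 2 : ℂ) • mpK j - (1 / 4 : ℂ) • ContinuousLinearMap.id ℂ _

/-- `ϖ(𝒲_λ) = ϖ(h)² + λ²·𝐇 − ¼` with `𝐇 = −∂² + (2πq)² = 2π · (2π(D²+X²))` (`hermiteOpCLM`; §3.3 p0008:L235, p0009:L10: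
"`W_λ = −S² + λ²𝐇 − ¼`", and `−S² = ϖ(h)²` for `S = −iϖ(h)`). [cite: ConnesConsaniMoscovici2024, §5.1 Prop. p0017:L56–L62] -/
theorem mpW_eq : mpW j lam = (mpH j).comp (mpH j) + ((lam : ℂ) ^ 2) • ((2 * π : ℂ) • hermiteOpCLM j) -
    (1 / 4 : ℂ) • ContinuousLinearMap.id ℂ _ := by
  rw [mpW, mpK_eq_half_hermiteOpCLM, smul_smul, smul_smul]
  congr 3
  ring

/-- **Proposition (§5.1, p0017:L56–L62) at the level of functions on `ℝ`**, against the §3 typing of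
`ProlateWaveCyclicPairs.lean` (`prolateWaveOpFun lam` = `W_λ` of eq. (5)/«(WLambdaq1)», `scalingOpFun` = `𝕊`,
`hermiteOpFun` = `𝐇`): "ϖ(h) is up to a factor of `i` the scaling `𝕊` while the Hermite operator is obtained as
ϖ(k)" (p0017:L14) — precisely `ϖ(h) = i𝕊` (`x∂ + ½ = i·(−i(x∂ + ½))`) and `ϖ(k) = 𝐇/4π` («(b-k)») — and then
`W_λ f = ϖ(h)(ϖ(h)f) + 4πλ²·ϖ(k)f − ¼f` for every `C²` function `f`, i.e. `W_λ = ϖ(h² + 4πλ²k − ¼)`.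
Proof = the displayed chain `W_λ = −𝕊² + λ²𝐇 − ¼` (p0009:L10–L11; tree: `prolateWaveOpFun_eq_add_hermite`,
`neg_scalingOpFun_sq_eq`). [cite: ConnesConsaniMoscovici2024, §5.1 Prop. p0017:L56–L62] -/
theorem prolateWaveOpFun_eq_varpi (lam : ℝ) {f : ℝ → ℂ} (hf : ContDiff ℝ 2 f) (x : ℝ) :
    prolateWaveOpFun lam f x =
      I * scalingOpFun (fun y => I * scalingOpFun f y) x +
        4 * π * lam ^ 2 * ((4 * π : ℂ)⁻¹ * hermiteOpFun f x) - f x / 4 := by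
  have hπ : (π : ℂ) ≠ 0 := Complex.ofReal_ne_zero.mpr Real.pi_ne_zero
  have hd0 : Differentiable ℝ f := hf.differentiable (by norm_num)
  have hd1 : Differentiable ℝ (deriv f) := hf.differentiable_deriv_two
  have hSd : DifferentiableAt ℝ (scalingOpFun f) x := by
    have h1 : DifferentiableAt ℝ (fun y : ℝ => (y : ℂ) * deriv f y + f y / 2) x :=
      ((Complex.ofRealCLM.differentiableAt).mul (hd1 x)).add ((hd0 x).div_const 2)
    exact h1.const_mul (-I)
  have hS : scalingOpFun (fun y => I * scalingOpFun f y) x = I * scalingOpFun (scalingOpFun f) x := by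
    have h1 : scalingOpFun (fun y => I * scalingOpFun f y) x =
        -I * ((x : ℂ) * deriv (fun y => I * scalingOpFun f y) x + I * scalingOpFun f x / 2) := rfl
    have h2 : scalingOpFun (scalingOpFun f) x = -I * ((x : ℂ) * deriv (scalingOpFun f) x + scalingOpFun f x / 2) :=
      rfl
    rw [h1, h2, deriv_const_mul I hSd]
    ring
  rw [hS, ← mul_assoc, I_mul_I, prolateWaveOpFun_eq_add_hermite lam hf, ← neg_scalingOpFun_sq_eq hf]
  field_simp
  ring

end Prolate

end Literature.NumberTheory.ConnesConsani2024
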